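import Summits.QuantumFields.BalabanUV.T4Continuum.Support.HistoryRPGibbsCuts
import Summits.QuantumFields.BalabanUV.T4Continuum.Support.HistoryChessboardPlaquetteBox
import Literature.MathematicalPhysics.QuantumFieldTheory.Balaban1983to89.T3UnitScaleTilt
import Literature.Probability.LatticeModels.ChessboardEstimateEvenTorus
import HarnessLib

/-!
# Sketch §6 (crux-ideate 2/2 on `stmt-QuantumFields-18916`, gen 3) — STUB 3 `stub_chessboardRP` of v5p IS A CONSUMER
# of the T⁴ cell's d-GENERAL RP road: the three T³ instances, PROVED BY NAME (no `sorry` in this file)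

Seat `ym-cruxidea-18916-2` (planner, crux-ideate ideator 2/2, lens NEGATION), card 1 «chessboard-collar-delocalisation»,
kill-test 1 (typed reduction of the chessboard stub).  Companion of `Sketch.lean` §1–§5 (same folder).

WHAT IS PROVED HERE (all `[folklore]` compositions of TREE theorems over `Setup.Params`, which is `d`-general; the T⁴ road
`Summits/QuantumFields/BalabanUV/T4Continuum/Support/HistoryRP*` never fixes `d = 4` below its `T4Family` headline files):

* §6.1 `avgIter_wallRefl` — (γ)/(R-sym) COVARIANCE: the `j`-fold EML average `Ū^j = (blockAvg ℰp)^j` intertwines the fine wall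
  reflection `θ_{ρ, L^j t} = τ_{−L^j t} ∘ c_ρ ∘ τ_{L^j t}` with the level-`j` wall reflection `θ_{ρ, t}` — BY NAME from
  `T4Continuum.iter_translate` ∕ `iter_creflect` fed with `BlockAveraging.blockAvg_translate` ∕ `blockAvg_creflect`.
  With `t = (k·L^s)·e_ρ` this is the reflection in the wall `x_ρ = k·L^{j+s} − ½` between level-`(j+s)` cells.
* §6.2 `dist1_plaqHol_wallRefl` ∕ `wallRefl_mem_largeEvt_iff` — the crux's event `E′_θ(q) = {θ ≤ dist1 Ū^j(∂q)}` is mapped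
  by `θ_{ρ, L^j t}` onto `E′_θ(q̄)`, `q̄ = mirrorPlaq ρ t q` (orientation reversal is invisible to `dist1`:
  `HistoryChessboardPlaquetteBox.dist1_plaqHol_creflect`, `GaugeField.plaqHol_translate`).
* §6.3 `gibbsK_rp_wall` — REFLECTION POSITIVITY of the crux's measure `gibbsK F ℰp γ K` (= `gibbsMeasure (F.P K) β_K`, `rfl`)
  about EVERY wall family `(i, k)`, `k·b − ½`, any block side `b`, any cell count `Nc`, for `γ ≥ 0` — BY NAME
  `HistoryRPGibbsCuts.isReflectionPositiveBdd_gibbs_blocks_SU` (+ the four structural members `rpPackage_gibbs_blocks`∕`_cut_SU`: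
  `mP ≤ m`, measurability, measure preservation, involution).
* §6.4 `chessboard_single_cell` — the abstract chessboard root for ONE cell: `ψ {c₀} ^ (N^d) ≤ ψ univ` from
  `Literature.Probability.LatticeModels.chessboard_pow_le_even` (`Even N`; fields `h0 ∕ hempty ∕ h1 ∕ hcs`).

WHAT REMAINS FOR STUB 3's PROVER (named, sized; NOT done here): (LOC) `largeEvt q` is `(mPos 0 i).comap (translate a)`-measurable
when the FOOTPRINT of `q` (lead's `UnitScaleTiltHistoryTailBlockFootprint/BlockRegions`: fine box `toFine j q.src + [0, 2L^j+σ_j]²×[0, L^j+σ_j]`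
+ issuing bonds, `σ_j = (L^j−L)/(L−1)`) lies in the positive half of the wall [M; pattern `HistoryRPTowerCells.measurable_coord_of_translate_mem_posBonds`,
`HistoryRPGibbsCuts.piFinset_le_mPos_comap_translate`]; the FIELDS `hcs` from §6.3 + §6.2 via
`HistoryChessboardRP.chessboardFields_of_isReflectionPositiveBdd` [M, by name]; `h1 : 0 < ψ univ` (positivity of the joint event:
a.e.-positive Wilson density × an interior point with alternating-sign cell fluxes) [S–M]; the T³ bookkeeping of v5p's text — `s` minimal with
`L^s ≥ ρ + 4` (so `L^s < L(ρ+4)`), the grid offset centring `p` in its cell, the mirror family `S` as a `Finset (Plaq (F.P K) j)` with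
pairwise `tdist ≥ L^s − 3 ≥ ρ + 1`, `#S = (2L^{m+K−j−s})³`, `sitesPerDir(j)³ = #S·L^{3s} ≤ #S·(L(ρ+4))³`, and the top-height branch
`m + K − j < s ⇒ S = {p}` [M].  Estimated total M–L (was «L–XL located» in v5p's docstring).

HONEST.  Nothing printed is asserted; no `Prop` fact minted; the cross-cell imports (`BalabanUV/T4Continuum/Support`) are tree modules —
if a YangMills `Theorems/` file may not import them, the three lemmas re-derive in < 80 lines from the Literature-level facts they wrap
(`T4Covariance`, `T4UndoubledRP`/`TorusReflectionPositivity`, `WilsonRP`).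
-/

open MeasureTheory Finset
open Literature.MathematicalPhysics.QuantumFieldTheory.Balaban1983to89
open Literature.MathematicalPhysics.QuantumFieldTheory.Balaban1983to89.T3ContinuumYM3Torus
open Literature.MathematicalPhysics.QuantumFieldTheory.Balaban1983to89.T3UnitScaleTilt
open Literature.MathematicalPhysics.QuantumFieldTheory.Balaban1983to89.T3UnitLawDensityEML (ℰp measurableE_ℰp)
open Literature.MathematicalPhysics.QuantumFieldTheory.LatticeRP (IsReflectionPositiveBdd)
open Literature.Probability.LatticeModels
open Literature.Barriers.CriticalPhenomena.NonGibbs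
open Summit.QuantumFields.BalabanUV.T4Continuum
open Summit.QuantumFields.BalabanUV.T4Continuum.HistoryRPHalfTorus (mPos)
open Summit.QuantumFields.BalabanUV.T4Continuum.HistoryChessboardPlaquetteBox (cplaq dist1_plaqHol_creflect)

namespace Summit.QuantumFields.YangMills.Cruxes.HistoryTail.Ideas18916i2RP

noncomputable section

/-- the crux's gauge group `SU(2)` (the pinned smearing `ℰp = expMeanLogSU (n := Fin 2)`). [folklore] -/
abbrev G2 : Type := Matrix.specialUnitaryGroup (Fin 2) ℂ

/-! ## §6.0 the objects -/

section Objects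

variable {P : Params} {j : ℕ} {G : Type*} [GaugeGroup G]

/-- **the conjugated WALL REFLECTION** `θ_{ρ,a} := τ_{−a} ∘ c_ρ ∘ τ_{a}` on configurations of `T^{(j)}` (`c_ρ` the tree's centre
reflection `x_ρ ↦ −x_ρ − 1`, a link-plane reflection about `x_ρ = −½`; conjugated: about `x_ρ = a_ρ − ½`).  The letter of
`HistoryRPGibbsCuts.rpPackage_gibbs_cut`. [folklore] -/
def wallRefl (ρ : Fin P.d) (a : Site P j) (U : GaugeField P j G) : GaugeField P j G :=
  ((U.translate a).creflect ρ).translate (-a)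

/-- the MIRROR PLAQUETTE of `q` under `θ_{ρ,t}` (same level): `τ_t ∘ c_ρ ∘ τ_{−t}` on labels. [folklore] -/
def mirrorPlaq (ρ : Fin P.d) (t : Site P j) (q : Plaq P j) : Plaq P j :=
  (cplaq ρ (q.translate (-t))).translate t

/-- **(R-sym) at one level**: `dist1 ((θ_{ρ,t} V)(∂q)) = dist1 (V(∂ q̄))`. [folklore] -/
theorem dist1_plaqHol_wallRefl (ρ : Fin P.d) (t : Site P j) (V : GaugeField P j G) (q : Plaq P j) :
    dist1 (GaugeField.plaqHol (wallRefl ρ t V) q) = dist1 (GaugeField.plaqHol V (mirrorPlaq ρ t q)) := by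
  unfold wallRefl mirrorPlaq
  rw [GaugeField.plaqHol_translate, dist1_plaqHol_creflect, GaugeField.plaqHol_translate]

end Objects

/-! ## §6.1 covariance of the iterated EML average under wall reflections (BY NAME from `T4Covariance`) -/

section Covariance

variable (F : T3Family)

/-- the crux's `j`-fold EML average `Ū^j` on run `K` (the letter of `stub_perPlaquetteHighRaw`). [folklore] -/
def avgIter (K j : ℕ) (U : GaugeField (F.P K) 0 G2) : GaugeField (F.P K) j G2 :=
  Averaging.iter (fun i => (BlockAveraging.blockAvg (P := F.P K) (j := i) ℰp : Averaging (F.P K) i G2)) j U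

/-- **§6.1 COVARIANCE**: `Ū^j (θ_{ρ, L^j t} U) = θ_{ρ, t} (Ū^j U)` — the fine wall reflection conjugated by the fine translation
`Site.scaleTo j t = L^j·t` is carried by the `j`-fold EML average to the level-`j` wall reflection by `t`.
BY NAME: `T4Continuum.iter_translate` (with `blockAvg_translate`) and `T4Continuum.iter_creflect` (with `blockAvg_creflect`). [folklore] -/
theorem avgIter_wallRefl (K j : ℕ) (ρ : Fin (F.P K).d) (t : Site (F.P K) j) (U : GaugeField (F.P K) 0 G2) :
    avgIter F K j (wallRefl ρ (Site.scaleTo j t) U) = wallRefl ρ t (avgIter F K j U) := by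
  have hT := T4Continuum.iter_translate
    (fun i => (BlockAveraging.blockAvg (P := F.P K) (j := i) ℰp : Averaging (F.P K) i G2))
    (fun i a V => BlockAveraging.blockAvg_translate ℰp a V) j
  have hR := T4Continuum.iter_creflect
    (fun i => (BlockAveraging.blockAvg (P := F.P K) (j := i) ℰp : Averaging (F.P K) i G2)) ρ
    (fun i V => BlockAveraging.blockAvg_creflect ℰp ρ V) j
  unfold avgIter wallRefl
  rw [← map_neg (Site.scaleTo j) t, hT (-t), hR, hT t]

/-! ## §6.2 the crux's event under wall reflections -/

/-- the crux's UV-large averaged-plaquette event at height `j` of run `K` (verbatim the set of `stub_perPlaquetteHighRaw`). [folklore] -/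
def largeEvt (γ b₀ p₀ : ℝ) (K j : ℕ) (q : Plaq (F.P K) j) : Set (GaugeField (F.P K) 0 G2) :=
  {U | θBal F.L γ b₀ p₀ (K - j) ≤ dist1 (GaugeField.plaqHol (avgIter F K j U) q)}

/-- **§6.2 (R-sym) FOR THE CRUX'S EVENT**: `θ_{ρ, L^j t} U ∈ E′(q) ↔ U ∈ E′(q̄)`, i.e. `θ⁻¹ E′(q) = E′(mirrorPlaq ρ t q)`. [folklore] -/
theorem wallRefl_mem_largeEvt_iff (γ b₀ p₀ : ℝ) (K j : ℕ) (ρ : Fin (F.P K).d) (t : Site (F.P K) j)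
    (q : Plaq (F.P K) j) (U : GaugeField (F.P K) 0 G2) :
    wallRefl ρ (Site.scaleTo j t) U ∈ largeEvt F γ b₀ p₀ K j q ↔ U ∈ largeEvt F γ b₀ p₀ K j (mirrorPlaq ρ t q) := by
  simp only [largeEvt, Set.mem_setOf_eq, avgIter_wallRefl, dist1_plaqHol_wallRefl]

/-- the same as an identity of preimages (the shape `hcov` of `HistoryChessboardRP.chessboardFields_of_isReflectionPositiveBdd`). [folklore] -/
theorem preimage_wallRefl_largeEvt (γ b₀ p₀ : ℝ) (K j : ℕ) (ρ : Fin (F.P K).d) (t : Site (F.P K) j) (q : Plaq (F.P K) j) :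
    wallRefl ρ (Site.scaleTo j t) ⁻¹' largeEvt F γ b₀ p₀ K j q = largeEvt F γ b₀ p₀ K j (mirrorPlaq ρ t q) := by
  ext U; exact wallRefl_mem_largeEvt_iff F γ b₀ p₀ K j ρ t q U

/-! ## §6.3 reflection positivity of the crux's measure about every wall (BY NAME from `HistoryRPGibbsCuts`) -/

/-- **§6.3 RP OF `gibbsK` ABOUT THE WALL FAMILY `(i, k)`, walls `k·b − ½`** (any block side `b`, any cell count `Nc`; `γ ≥ 0`):
`HistoryRPGibbsCuts.isReflectionPositiveBdd_gibbs_blocks_SU` at `P := F.P K`, `β := β_K = (γ ε_K)⁻¹ ≥ 0`. [folklore] -/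
theorem gibbsK_rp_wall {γ : ℝ} (hγ : 0 ≤ γ) (K b Nc : ℕ) (i : Fin (F.P K).d) (k : ZMod Nc) :
    IsReflectionPositiveBdd (gibbsK F ℰp γ K)
      ((mPos G2 0 i).comap (GaugeField.translate ((k.val * b) • (0 : Site (F.P K) 0).shift i)))
      (fun U : GaugeField (F.P K) 0 G2 =>
        ((U.translate ((k.val * b) • (0 : Site (F.P K) 0).shift i)).creflect i).translate
          (-((k.val * b) • (0 : Site (F.P K) 0).shift i))) :=
  HistoryRPGibbsCuts.isReflectionPositiveBdd_gibbs_blocks_SU (F.P K) (F.scheme_β_nonneg ℰp hγ K) b Nc i k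

/-- the reflection of §6.3 IS `wallRefl i ((k·b)·e_i)` (definitional). [folklore] -/
theorem gibbsK_rp_wall' {γ : ℝ} (hγ : 0 ≤ γ) (K b Nc : ℕ) (i : Fin (F.P K).d) (k : ZMod Nc) :
    IsReflectionPositiveBdd (gibbsK F ℰp γ K)
      ((mPos G2 0 i).comap (GaugeField.translate ((k.val * b) • (0 : Site (F.P K) 0).shift i)))
      (wallRefl i ((k.val * b) • (0 : Site (F.P K) 0).shift i)) :=
  gibbsK_rp_wall F hγ K b Nc i k

/-- the four STRUCTURAL members for the same family (σ-algebra bound, measurability, `gibbsK`-preservation, involution) —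
`HistoryRPGibbsCuts.rpPackage_gibbs_cut_SU`. [folklore] -/
theorem gibbsK_wall_package {γ : ℝ} (hγ : 0 ≤ γ) (K : ℕ) (i : Fin (F.P K).d) (a : Site (F.P K) 0) :
    (mPos G2 0 i).comap (GaugeField.translate a) ≤ (inferInstance : MeasurableSpace (GaugeField (F.P K) 0 G2)) ∧
      Measurable (wallRefl (G := G2) i a) ∧
      MeasurePreserving (wallRefl i a) (gibbsK F ℰp γ K) (gibbsK F ℰp γ K) ∧
      wallRefl (G := G2) i a ∘ wallRefl i a = id ∧
      IsReflectionPositiveBdd (gibbsK F ℰp γ K) ((mPos G2 0 i).comap (GaugeField.translate a)) (wallRefl i a) :=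
  HistoryRPGibbsCuts.rpPackage_gibbs_cut_SU (F.P K) (F.scheme_β_nonneg ℰp hγ K) i a

/-! ## §6.4 the abstract chessboard root for one cell (BY NAME from `ChessboardEstimateEvenTorus`) -/

/-- **§6.4 ONE-CELL CHESSBOARD ROOT**: for a pattern functional `ψ` on the cells of an even `d`-torus of side `N` with the four
chessboard fields, `ψ {c₀} ^ (N ^ d) ≤ ψ univ` — v5p STUB 3's inequality `Gibbs(E′(p)) ≤ Gibbs(⋂_{q ∈ S} E′(q))^{1/#S}` once
`ψ S := gibbsK (⋂_{c ∈ S} E′(q_c))`, `#S = N^d`, `N = 2L^{m+K−j−s}`. [folklore] -/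
theorem chessboard_single_cell {d N : ℕ} [NeZero N] (hN : Even N) {ψ : Finset (BlockIdx d N) → ℝ}
    (h0 : ∀ S, 0 ≤ ψ S) (hempty : ψ ∅ ≤ 1) (h1 : 0 < ψ univ)
    (hcs : ∀ (i : Fin d) (k : ZMod N) (S : Finset (BlockIdx d N)), ψ S ^ 2 ≤ ψ (symP i k S) * ψ (symM i k S))
    (c₀ : BlockIdx d N) : ψ {c₀} ^ (N ^ d) ≤ ψ univ := by
  simpa using chessboard_pow_le_even hN h0 hempty h1 hcs {c₀}

/-- … in ROOT form: `ψ {c₀} ≤ (ψ univ) ^ (1 / N^d)` (real power; `0 < N`). [folklore] -/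
theorem chessboard_single_cell_rpow {d N : ℕ} [NeZero N] (hN : Even N) {ψ : Finset (BlockIdx d N) → ℝ}
    (h0 : ∀ S, 0 ≤ ψ S) (hempty : ψ ∅ ≤ 1) (h1 : 0 < ψ univ)
    (hcs : ∀ (i : Fin d) (k : ZMod N) (S : Finset (BlockIdx d N)), ψ S ^ 2 ≤ ψ (symP i k S) * ψ (symM i k S))
    (c₀ : BlockIdx d N) : ψ {c₀} ≤ (ψ univ) ^ ((1 : ℝ) / (N ^ d : ℕ)) := by
  have hpow := chessboard_single_cell hN h0 hempty h1 hcs c₀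
  have hNd : 0 < (N ^ d : ℕ) := pow_pos (Nat.pos_of_ne_zero (NeZero.ne N)) d
  have hψ0 : 0 ≤ ψ {c₀} := h0 _
  calc ψ {c₀} = (ψ {c₀} ^ (N ^ d)) ^ ((1 : ℝ) / (N ^ d : ℕ)) := by
        rw [← Real.rpow_natCast, ← Real.rpow_mul hψ0, Nat.cast_pow]
        rw [mul_one_div, div_self (by exact_mod_cast hNd.ne'), Real.rpow_one]
    _ ≤ (ψ univ) ^ ((1 : ℝ) / (N ^ d : ℕ)) :=
        Real.rpow_le_rpow (pow_nonneg hψ0 _) hpow (by positivity)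

end Covariance

end

end Summit.QuantumFields.YangMills.Cruxes.HistoryTail.Ideas18916i2RP
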